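import Summits.CriticalPhenomena.PercolationContinuityZ3.Theorems.FK.Transplant.KNFreeSlabUFSC0
import Summits.CriticalPhenomena.PercolationContinuityZ3.Theorems.FK.Transplant.FHSlabThreshold
import Summits.CriticalPhenomena.PercolationContinuityZ3.Theorems.FK.Transplant.UFSC0SlabPercolation
import Summits.CriticalPhenomena.PercolationContinuityZ3.Theorems.FK.InfiniteVolumeStochasticOrder
import HarnessLib

/-!
# FRONTIER TRANSPLANT — the SLAB ROUTE at and near criticality: no free-slab percolation at `p_c(q)` for any
# `q ≥ 1`; the slab-threshold conjecture (5.103) decides crux C3a at every `p` EXCEPT `p = p_c(q)`; the Ising case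
# `q = 2` (given Bodineau's theorem): every crux of the programme is inhabited, the record's binder 2 is idle;
# finite free slabs `Π(p, L)` ⟹ the free measure `φ⁰_{p,q}` percolates in a slab at the SAME `p` (every `q ≥ 1`)

Support file (`--supports stmt-CriticalPhenomena-4575`, helper; LEAF — nothing imports it) of the FRONTIER TRANSPLANT
sub-cell (`fk-continuity/transplant/`, seat `prim-bschramm-fkt-p3`); builds on p205010 (kernel theorem, internal audit
signed; external expert review pending). 0 definitions · 0 named facts introduced · 0 sorries · standard axioms. ONE
consumer of the slab route's conclusion `ufsc0_of_fkSlabPercolation` (row T4s, file 18, fkt-p1) composed with the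
UNCONDITIONAL cruxes C2 `fkContinuationPrinciple` (p248242) and C3b `fkLawfulOfCriterion` (p248560) through row FT-07's leaf
`rcCriticalProb_lt_of_ufsc0_of_one_le` / `noUFSC0AtCritical` (`KNFreeTheorem6Consequences`) and FO-12's
`fkContinuityFree_of_criterionOfThetaFree` (`NoCriterionAtCritical`).
Registered R66 (cell INBOX l.4851, 2026-08-23); registry row T4c; lead label T4c-A (fkt-lead L25, l.4830; delta reads:
L26, l.4852; L29, l.4922).

HONEST FRAMING (page 1, cell rule). The transplant's theorem of record `ufsc0_of_freeBoundaryHypothesis_r3` (p248245) is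
CONDITIONAL on FH AND on TP_FK = `KNFreeTargetHittable d q p`, both OPEN at the same `p` for `q > 1` near `p_c(q)` (⇔ GRC
Conj. (5.103) via K1; barrier note `Literature.Barriers.CriticalPhenomena.SamePFreeBoundaryCriteria`, FBN-01, cited
first); the transplant is a typed reduction, not a proof of FK continuity. THIS FILE is a CALIBRATION leaf of what the
slab route does and does not give AT criticality: NOT a discharge of FH or TP_FK, NOT `_r4`, no FH / TP_FK concluder for
`q > 1`; `_r3` « 2 / 0 ☑ », n_open = 2, BINDER-OWNERS, FO-19 NO-GO unchanged. Every `q = 2` statement is CONDITIONAL on the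
displayed named fact `Bodineau2005_slabThreshold` (`p̂_c(2) = p_c(2)`, Bodineau 2005 Thm. 2.1 / Severo 2024 Thm. 1.1; not
proved in the tree), and §3 says in each docstring where the continuity of the 3D Ising transition (ADS 2015, tree
`free_two` / `thetaFree_rcCriticalProb_two_eq_zero`) is CONSUMED — so nothing here is a new proof of Ising continuity.

## Contents (namespace `Summit.CriticalPhenomena.PercolationContinuityZ3.Theorems.FK`)

§1 (every `q ≥ 1`, `d ≥ 3`, UNCONDITIONAL). `rcCriticalProb_lt_of_fkSlabPercolation`: Grimmett's slab property
`Π(p, L)` at ANY thickness `L` and `0 < p < 1` forces the STRICT inequality `p_c(q) < p` (print: "clearly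
`p_c(q) ≤ p̂_c(q)`", the tree's `rcCriticalProb_le_of_fkSlabPercolation`; strictness is the finite-size-criterion
route: `Π(p, L) ⟹ UFSC0` (T4s) `⟹` a sound robustly lawful scheme (C3b) `⟹ p_c(q) < p` (C2, continuity of the
minimal laws in `p`)). Hence `not_fkSlabPercolation_at_critical`: **the free random-cluster measures of the slabs
`S(L, N)` do NOT percolate (in the sense `Π`) at `p = p_c(q)`, for every `q ≥ 1` and every thickness** — the slab
analogue, for all `q ≥ 1` at once, of "no percolation at criticality in slabs"; and `not_fkSlabPercolation_of_le_rcCriticalProb`.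

§2 (every `q ≥ 1`, `d ≥ 3`; displayed hypothesis `h5103 : p̂_c(q) = p_c(q)`, Conj. (5.103) for this `q`, NOT asserted).
`ufsc0_of_ne_critical_of_slabThreshold_eq`: granted (5.103) for `q`, crux C3a's implication
`0 < θ⁰(p,q) ⟹ ∃ r, UFSC0 d q p r ε₀` holds at EVERY `p ∈ (0,1)` with `p ≠ p_c(q)`;
`fkCriterionOfThetaFree_of_slabThreshold_eq`: (5.103)_q ∧ `FKContinuityFree d q` ⟹ C3a(q);
`fkCriterionOfThetaFree_iff_fkContinuityFree_of_slabThreshold_eq`: **granted (5.103)_q, C3a(q) ⟺ FKContinuityFree(q)**;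
and UNCONDITIONALLY `fkCriterionOfThetaFree_iff_fkContinuityFree_and_gap`:
**C3a(q) ⟺ FKContinuityFree(q) ∧ [`∃ r, UFSC0 d q p r ε₀` at every `p ∈ (p_c(q), p̂_c(q)] ∩ (0,1)`]** — the crux is the
target plus the criterion on the K1 GAP INTERVAL, nothing else (`ufsc0_of_rcCriticalProb_lt_of_fkCriterionOfThetaFree`:
the gap clause is necessary).
Reading (K1 sharpened, numbers not adjectives): the slab-threshold conjecture would settle every instance of the
programme's one open crux C3a EXCEPT the single instance `p = p_c(q)` that row FO-05's composition
`fkContinuityFree_of_cruxes` consumes — and that instance is the target itself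
(`criterionOfThetaFree_at_critical_iff_fkContinuityFree`, FO-12). What the finite-size route needs for `q ∈ (1,2)` is
the SAME-`p` criterion AT `p_c(q)` (Kozma–Nitzan's `q = 1` theorem has no sprinkling), not (5.103).

§3 (`q = 2`, `d ≥ 3`, given `hB : Bodineau2005_slabThreshold`). `fkCriterionOfThetaFree_two`: crux C3a HOLDS at `q = 2`
— so with C2/C3b (unconditional) and `fkCriterionOfThetaFree_one` every crux of row FO-05's typed layer is inhabited at
`q ∈ {1, 2}`; its proof CONSUMES `free_two` (ADS 2015) at `p = p_c(2)`, hence the programme's composition at `q = 2` is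
circular as a proof of Ising continuity (said here once, and in the docstring). `exists_ufsc0_two_iff_rcCriticalProb_lt`:
for `p ∈ (0,1)` and `4ε₀ < 2⁻³²`, `(∃ r, UFSC0 d 2 p r ε₀) ↔ p_c(2) < p` — the record's CONCLUSION at `q = 2` is decided
at every `p`; `ufsc0_two_of_fh`: at `q = 2` the record's binder 2 is IDLE (`FH d 2 p` alone gives the conclusion);
`exists_ufsc0_two_iff_fh`; `ising_slabRoute_tfae`: for `p ∈ (0,1)`,
TFAE `[p_c(2) < p, ∃ L Π(p,L), FH d 2 p, ∃ r UFSC0 d 2 p r ε₀, 0 < θ⁰(p,2)]`.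

§4 (every `q ≥ 1`, `d ≥ 3`, UNCONDITIONAL). `csInf_ufsc0Set_mem_Icc`: the `p`-threshold of the record's conclusion,
`inf {x ∈ (0,1] | ∃ r, UFSC0 d q x r ε₀}` (inline, no definition), lies in the K1 interval `[p_c(q), p̂_c(q)]`.

§5 (every `q ≥ 1`, `d ≥ 3`). `slabPercolation_rcLimit_free_of_fkSlabPercolation`: Grimmett's FINITE free-slab property
`Π(p, L)` (`0 < p < 1`) forces the FREE infinite-volume measure `φ⁰_{p,q} = rcLimit d false p q` to percolate inside a
slab AT THE SAME `p` — T4s `ufsc0_of_fkSlabPercolation` composed with the sister leaf `UFSC0SlabPercolation`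
(`slabPercolation_rcLimit_free_of_ufsc0`: the record's conclusion IS free-measure slab percolation at the same `p`);
`slabPercolation_fkGibbs_of_ufsc0`: `UFSC0` at `p` ⟹ EVERY `FKGibbs` (DLR) measure at `(p, q)` percolates inside a slab at the
SAME `p` (the minimal measure `φ⁰_{p,q}` does, and `φ⁰_{p,q} ≤ P` on increasing events, Grimmett Thm. (4.34)(b)).

## References

* G. Grimmett, *The Random-Cluster Model*, Springer 2006: §5.1 Thm. (5.5), (5.1)–(5.3); §5.7 eq. (5.102),
  Conj. (5.103), Thm. (5.104); Conj. (6.32)(a) [Grimmett2006].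
* G. Kozma, S. Nitzan, arXiv:2401.12397 (2024), §1 p. 2 (approach 1), §4 Theorem 6 (pp. 25–31) [KozmaNitzan2024].
* T. Bodineau, PTRF 132 (2005), Thm. 2.1 [Bodineau2005]; F. Severo, Thm. 1.1, Thm. 1.3 [Severo2024].
* M. Aizenman, H. Duminil-Copin, V. Sidoravicius, CMP 334 (2015), Thm. 1.2 [AizenmanDuminilCopinSidoraviciusCMP2015].
* H. Duminil-Copin, V. Tassion, Moscow Math. J. (2019), §5 Question 5 [DuminilCopinTassion2019].
* G. Grimmett, *Percolation*, 2nd ed., Springer 1999, §7.2 Thm. (7.2) (Grimmett–Marstrand: slab percolation) [GrimmettPercolation1999].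
-/

noncomputable section

open MeasureTheory
open scoped ENNReal Classical

namespace Summit.CriticalPhenomena.PercolationContinuityZ3.Theorems.FK

open Literature.Probability.Percolation Literature.Probability.LatticeModels
open Literature.Probability.Percolation.KozmaNitzan Literature.Barriers.CriticalPhenomena

variable {d : ℕ} {q ε₀ : ℝ}

/-! ### §1. No free-slab percolation at `p_c(q)`: `Π(p, L)` forces `p_c(q) < p`, every `q ≥ 1`, `d ≥ 3` -/

/-- **`Π(p, L) ⟹ p_c(q) < p`, STRICT** (`d ≥ 3`, `q ≥ 1`, `0 < p < 1`, any thickness `L`): free slab percolation at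
`p` forces `p` to lie STRICTLY above the critical point. Route: `Π(p, L) ⟹ ∃ r, UFSC0 d q p r 2⁻³⁵` (T4s
`ufsc0_of_fkSlabPercolation`), then C3b ∧ C2 (`rcCriticalProb_lt_of_ufsc0_of_one_le`, unconditional). In print only
`p_c(q) ≤ p̂_c(q)` is recorded ("clearly"); the strict form is the finite-size-criterion content of the slab route.
[cite: Grimmett2006, §5.7 eq. (5.102) ("Clearly p_c(q) ≤ p̂_c(q) < 1"), Thm. (5.5)]
[cite: KozmaNitzan2024, §1 p. 2 (approach 1), §4 Theorem 6 (pp. 25–31)] -/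
theorem rcCriticalProb_lt_of_fkSlabPercolation (hd : 3 ≤ d) (hq : 1 ≤ q) (p : unitInterval)
    (hp : (p : ℝ) ∈ Set.Ioo 0 1) {L : ℕ} (hSP : FKSlabPercolation d (p : ℝ) q L) :
    rcCriticalProb d q < (p : ℝ) := by
  have hε : (0 : ℝ) < (1 / 2) ^ 35 := by positivity
  obtain ⟨r, hU⟩ := ufsc0_of_fkSlabPercolation hd hq hε p hp hSP
  exact rcCriticalProb_lt_of_ufsc0_of_one_le hq (by norm_num) hp.1 hp.2 hU

/-- Real-parameter form of `rcCriticalProb_lt_of_fkSlabPercolation`: `Π(p, L)` with `p ∈ (0,1)` gives `p_c(q) < p`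
(`d ≥ 3`, `q ≥ 1`). [cite: Grimmett2006, §5.7 eq. (5.102), Thm. (5.5)] [cite: KozmaNitzan2024, §4 Theorem 6] -/
theorem rcCriticalProb_lt_of_fkSlabPercolation' (hd : 3 ≤ d) (hq : 1 ≤ q) {p : ℝ} (hp : p ∈ Set.Ioo (0 : ℝ) 1)
    {L : ℕ} (hSP : FKSlabPercolation d p q L) : rcCriticalProb d q < p :=
  rcCriticalProb_lt_of_fkSlabPercolation hd hq ⟨p, hp.1.le, hp.2.le⟩ hp hSP

/-- **No free-slab percolation AT criticality, every `q ≥ 1`, `d ≥ 3`, every thickness**: Grimmett's property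
`Π(p_c(q), L)` fails for every `L` — `inf_{N, x} φ⁰_{S(L,N), p_c(q), q}(0 ↔ x) = 0` is NOT bounded away from `0`. For
`q = 1` this is the slab form of "no percolation at `p_c` in slabs"; for `q > Q(d)` it is implied by the first-order
barrier (the free phase does not even percolate in `ℤ^d` at `p_c(q)`); for `q ∈ (1, 2]`, `d ≥ 3` it is the tree's
statement, by the finite-size-criterion route (`0 < p_c(q) < 1`, Thm. (5.5)).
[cite: Grimmett2006, §5.7 eq. (5.102), Conj. (5.103), Thm. (5.5)] [cite: KozmaNitzan2024, §4 Theorem 6] -/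
theorem not_fkSlabPercolation_at_critical (hd : 3 ≤ d) (hq : 1 ≤ q) (L : ℕ) :
    ¬ FKSlabPercolation d (rcCriticalProb d q) q L := fun hSP =>
  lt_irrefl _ (rcCriticalProb_lt_of_fkSlabPercolation' hd hq (rcCriticalProb_mem_Ioo (by omega) hq) hSP)

/-- **`Π(p, L)` fails on the whole of `[0, p_c(q)]`** (`d ≥ 3`, `q ≥ 1`): `Π` is monotone in `p`
(`FKSlabPercolation.mono`, (3.22)) and fails at `p_c(q)`. So `{p ∈ [0,1] : Π(p, L)} ⊆ (p_c(q), 1]` for every `L`.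
[cite: Grimmett2006, Thm. (3.21) eq. (3.22), §5.7 eq. (5.102)] -/
theorem not_fkSlabPercolation_of_le_rcCriticalProb (hd : 3 ≤ d) (hq : 1 ≤ q) {p : ℝ} (hp : p ∈ Set.Icc (0 : ℝ) 1)
    (hle : p ≤ rcCriticalProb d q) (L : ℕ) : ¬ FKSlabPercolation d p q L := fun hSP =>
  not_fkSlabPercolation_at_critical hd hq L (hSP.mono hp (rcCriticalProb_mem_Icc d q) hle hq)

/-- **The `Π`-region lies inside `(p_c(q), 1]`**: for `d ≥ 3`, `q ≥ 1`, `p ∈ [0,1]` and any `L`, `Π(p, L) → p_c(q) < p`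
(no restriction `p < 1`: at `p = 1` the conclusion is `p_c(q) < 1`, Thm. (5.5)).
[cite: Grimmett2006, §5.7 eq. (5.102), Thm. (5.5)] -/
theorem rcCriticalProb_lt_of_fkSlabPercolation_Icc (hd : 3 ≤ d) (hq : 1 ≤ q) {p : ℝ} (hp : p ∈ Set.Icc (0 : ℝ) 1)
    {L : ℕ} (hSP : FKSlabPercolation d p q L) : rcCriticalProb d q < p :=
  lt_of_not_ge fun hle => not_fkSlabPercolation_of_le_rcCriticalProb hd hq hp hle L hSP

/-! ### §2. Granted Conj. (5.103) for this `q`, crux C3a holds at every `p ≠ p_c(q)` — and ONLY the `p_c(q)` instance is left -/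

/-- **(5.103)_q ⟹ `UFSC0` on the whole supercritical phase** (`d ≥ 3`, `q ≥ 1`, `ε₀ > 0`): if `p̂_c(q) = p_c(q)`
(displayed hypothesis, Conj. (5.103) for this `q`; in print a theorem for `q ∈ {1,2}` only; NOT asserted) then every
`p ∈ (p_c(q), 1)` has `∃ r, UFSC0 d q p r ε₀` (T4s `ufsc0_of_fkSlabCriticalProb_lt`).
[cite: Grimmett2006, §5.7 Conj. (5.103), eq. (5.102)] [cite: KozmaNitzan2024, §4 Theorem 6] -/
theorem ufsc0_of_rcCriticalProb_lt_of_slabThreshold_eq (hd : 3 ≤ d) (hq : 1 ≤ q) (hε₀ : 0 < ε₀)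
    (h5103 : fkSlabCriticalProb d q = rcCriticalProb d q) (p : unitInterval) (hp : (p : ℝ) ∈ Set.Ioo 0 1)
    (hlt : rcCriticalProb d q < (p : ℝ)) : ∃ r : ℕ, UFSC0 d q p r ε₀ :=
  ufsc0_of_fkSlabCriticalProb_lt hd hq hε₀ p hp (by rwa [h5103])

/-- **(5.103)_q ⟹ C3a at every `p ≠ p_c(q)`** (`d ≥ 3`, `q ≥ 1`, `ε₀ > 0`): granted `p̂_c(q) = p_c(q)`, for every
`p ∈ (0,1)` with `p ≠ p_c(q)` the implication `0 < θ⁰(p,q) → ∃ r, UFSC0 d q p r ε₀` of crux C3a HOLDS — below `p_c(q)`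
vacuously (`θ⁰ = 0`, (5.3)), above `p_c(q)` by the slab route. The one instance NOT covered is `p = p_c(q)`.
[cite: Grimmett2006, §5.7 Conj. (5.103), §5.1 (5.1)–(5.3)] [cite: KozmaNitzan2024, §4 Theorem 6] -/
theorem ufsc0_of_ne_critical_of_slabThreshold_eq (hd : 3 ≤ d) (hq : 1 ≤ q) (hε₀ : 0 < ε₀)
    (h5103 : fkSlabCriticalProb d q = rcCriticalProb d q) (p : unitInterval) (hp : (p : ℝ) ∈ Set.Ioo 0 1)
    (hne : (p : ℝ) ≠ rcCriticalProb d q) (hθ : 0 < thetaFree d p q) : ∃ r : ℕ, UFSC0 d q p r ε₀ :=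
  ufsc0_of_rcCriticalProb_lt_of_slabThreshold_eq hd hq hε₀ h5103 p hp
    (lt_of_le_of_ne (rcCriticalProb_le_of_thetaFree_pos hq p.2 hθ) hne.symm)

/-- **(5.103)_q ∧ free continuity ⟹ crux C3a** (`d ≥ 3`, `q ≥ 1`, `ε₀ > 0`): granted `p̂_c(q) = p_c(q)` AND
`FKContinuityFree d q` (`θ⁰(p_c(q), q) = 0` — the programme's TARGET), `FKCriterionOfThetaFree d q ε₀` holds: at
`p = p_c(q)` the hypothesis `0 < θ⁰` is void, elsewhere `ufsc0_of_ne_critical_of_slabThreshold_eq`. Both hypotheses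
displayed, neither asserted. [cite: Grimmett2006, Conj. (5.103), Conj. (6.32)(a)] [cite: KozmaNitzan2024, §4 Theorem 6] -/
theorem fkCriterionOfThetaFree_of_slabThreshold_eq (hd : 3 ≤ d) (hq : 1 ≤ q) (hε₀ : 0 < ε₀)
    (h5103 : fkSlabCriticalProb d q = rcCriticalProb d q) (hT : FKContinuityFree d q) :
    FKCriterionOfThetaFree d q ε₀ := fun p hp0 hp1 hθ => by
  refine ufsc0_of_ne_critical_of_slabThreshold_eq hd hq hε₀ h5103 p ⟨hp0, hp1⟩ (fun heq => ?_) hθ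
  have h0 : thetaFree d (p : ℝ) q = 0 := by rw [heq]; exact (fkContinuityFree_iff d q).1 hT
  exact hθ.ne' h0

/-- **Granted Conj. (5.103) for this `q`, crux C3a IS the target** (`d ≥ 3`, `q ≥ 1`, `0 < ε₀`, `4ε₀ < 2⁻³²`):
`p̂_c(q) = p_c(q) → (FKCriterionOfThetaFree d q ε₀ ↔ FKContinuityFree d q)`. (→) is row FO-05/FO-12's composition with
the unconditional C2, C3b (`fkContinuityFree_of_criterionOfThetaFree`, no use of (5.103)); (←) is
`fkCriterionOfThetaFree_of_slabThreshold_eq`. CALIBRATION (K1 sharpened): the slab-threshold conjecture settles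
every instance of C3a except `p = p_c(q)`, and that instance is equivalent to the target
(`criterionOfThetaFree_at_critical_iff_fkContinuityFree`); so for `q ∈ (1,2)` the finite-size route needs the SAME-`p`
criterion AT `p_c(q)`, which (5.103) does not supply. Nothing asserted about (5.103).
[cite: Grimmett2006, Conj. (5.103), Conj. (6.32)(a)] [cite: KozmaNitzan2024, §1 p. 2 (approach 1), §4 Theorem 6]
[cite: DuminilCopinTassion2019, §5 Question 5] -/
theorem fkCriterionOfThetaFree_iff_fkContinuityFree_of_slabThreshold_eq (hd : 3 ≤ d) (hq : 1 ≤ q)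
    (hε₀ : 0 < ε₀) (hε : 4 * ε₀ < (1 / 2 : ℝ) ^ 32) (h5103 : fkSlabCriticalProb d q = rcCriticalProb d q) :
    FKCriterionOfThetaFree d q ε₀ ↔ FKContinuityFree d q :=
  ⟨fkContinuityFree_of_criterionOfThetaFree (by omega) hq hε,
    fkCriterionOfThetaFree_of_slabThreshold_eq hd hq hε₀ h5103⟩

/-- **Crux C3a DECOMPOSED, unconditionally** (`d ≥ 3`, `q ≥ 1`, `0 < ε₀`, `4ε₀ < 2⁻³²`):
`FKCriterionOfThetaFree d q ε₀ ↔ FKContinuityFree d q ∧ (UFSC0 at every p ∈ (p_c(q), p̂_c(q)] ∩ (0,1))`.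
The crux is EXACTLY the target plus the uniform finite-size criterion on the K1 GAP INTERVAL `(p_c(q), p̂_c(q)]`:
below `p_c(q)` C3a is void (`θ⁰ = 0`), at `p_c(q)` it is the target (FO-12), on the gap it is its own content, above
`p̂_c(q)` it is the slab route (T4s `ufsc0_of_fkSlabCriticalProb_lt`). For `q ∈ {1, 2}` the gap is EMPTY in print
(Grimmett–Marstrand; Bodineau — `fkCriterionOfThetaFree_two` below); for `q ∈ (1,2)` its length is Conj.
(5.103)'s defect `p̂_c(q) - p_c(q)`. No hypothesis beyond the tree; nothing asserted about the gap.
[cite: Grimmett2006, §5.7 eq. (5.102), Conj. (5.103), Conj. (6.32)(a), §5.1 (5.3)] [cite: KozmaNitzan2024, §1 p. 2 (approach 1), §4 Theorem 6] -/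
theorem fkCriterionOfThetaFree_iff_fkContinuityFree_and_gap (hd : 3 ≤ d) (hq : 1 ≤ q) (hε₀ : 0 < ε₀)
    (hε : 4 * ε₀ < (1 / 2 : ℝ) ^ 32) :
    FKCriterionOfThetaFree d q ε₀ ↔
      FKContinuityFree d q ∧
        ∀ p : unitInterval, rcCriticalProb d q < (p : ℝ) → (p : ℝ) ≤ fkSlabCriticalProb d q → (p : ℝ) < 1 →
          ∃ r : ℕ, UFSC0 d q p r ε₀ := by
  refine ⟨fun h3a => ⟨fkContinuityFree_of_criterionOfThetaFree (by omega) hq hε h3a, fun p hlt _ hp1 => ?_⟩,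
    fun ⟨hT, hgap⟩ p hp0 hp1 hθ => ?_⟩
  · exact h3a p ((rcCriticalProb_pos (by omega) hq).trans hlt) hp1
      (Literature.Barriers.CriticalPhenomena.thetaFree_pos_of_rcCriticalProb_lt (by omega) hq p.2 hlt)
  · have hle : rcCriticalProb d q ≤ (p : ℝ) := rcCriticalProb_le_of_thetaFree_pos hq p.2 hθ
    have hne : (p : ℝ) ≠ rcCriticalProb d q := fun heq => by
      have h0 : thetaFree d (p : ℝ) q = 0 := by rw [heq]; exact (fkContinuityFree_iff d q).1 hT
      exact hθ.ne' h0
    have hlt : rcCriticalProb d q < (p : ℝ) := lt_of_le_of_ne hle hne.symm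
    rcases le_or_gt (p : ℝ) (fkSlabCriticalProb d q) with hgp | hgp
    · exact hgap p hlt hgp hp1
    · exact ufsc0_of_fkSlabCriticalProb_lt hd hq hε₀ p ⟨hp0, hp1⟩ hgp

/-- **The gap clause alone**: C3a gives `UFSC0` at every `p ∈ (p_c(q), 1)` (`d ≥ 1`, `q ≥ 1`; the free phase
percolates there, (5.3) with `θ⁰ = θ¹` off countably many `p` — tree `thetaFree_pos_of_rcCriticalProb_lt`). The
converse `(∀ p ∈ (p_c(q),1), ∃ r, UFSC0 d q p r ε₀) → p̂_c(q) = p_c(q)` would be K1 as a kernel statement; it needs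
`UFSC0 ⟹ Π` (the run read as free-slab two-point percolation), which the tree does not have — NOT claimed.
[cite: Grimmett2006, §5.1 (5.3), Thm. (4.63), Conj. (5.103)] [cite: KozmaNitzan2024, §4 Theorem 6] -/
theorem ufsc0_of_rcCriticalProb_lt_of_fkCriterionOfThetaFree (hd : 1 ≤ d) (hq : 1 ≤ q)
    (h3a : FKCriterionOfThetaFree d q ε₀) (p : unitInterval) (hlt : rcCriticalProb d q < (p : ℝ))
    (hp1 : (p : ℝ) < 1) : ∃ r : ℕ, UFSC0 d q p r ε₀ :=
  h3a p ((rcCriticalProb_pos hd hq).trans hlt) hp1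
    (Literature.Barriers.CriticalPhenomena.thetaFree_pos_of_rcCriticalProb_lt hd hq p.2 hlt)

/-! ### §3. The Ising case `q = 2`, `d ≥ 3`, given Bodineau's theorem `p̂_c(2) = p_c(2)` -/

/-- **Crux C3a HOLDS at `q = 2`** (`d ≥ 3`, every `ε₀ > 0`), given the displayed named fact
`Bodineau2005_slabThreshold`: `FKCriterionOfThetaFree d 2 ε₀`. With `fkCriterionOfThetaFree_one` (q = 1, KN) and the
unconditional C2/C3b, every crux of row FO-05's typed layer is thus inhabited at `q ∈ {1, 2}`. HONEST NOTE: the proof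
CONSUMES the continuity of the 3D Ising transition (`free_two`: `θ⁰(p_c(2),2) = 0`, Aizenman–Duminil-Copin–Sidoravicius
2015 through the tree) to exclude `p = p_c(2)`, and Bodineau's theorem above `p_c(2)`; feeding this C3a into
`fkContinuityFree_of_criterionOfThetaFree` returns `free_two` — circular as a proof of Ising continuity, a consistency
statement of the typed crux layer, nothing more. [cite: Bodineau2005, Thm. 2.1] [cite: Severo2024, Thm. 1.1]
[cite: AizenmanDuminilCopinSidoraviciusCMP2015, Thm. 1.2] [cite: Grimmett2006, Conj. (5.103), Conj. (6.32)(a)] -/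
theorem fkCriterionOfThetaFree_two (hB : Bodineau2005_slabThreshold) (hd : 3 ≤ d) (hε₀ : 0 < ε₀) :
    FKCriterionOfThetaFree d 2 ε₀ :=
  fkCriterionOfThetaFree_of_slabThreshold_eq hd (by norm_num) hε₀ (hB d hd) (free_two hd)

/-- **`q = 2`, `d ≥ 3`: the record's CONCLUSION is decided at every `p`** (given Bodineau's theorem): for `p ∈ (0,1)`,
`ε₀ > 0` with `4ε₀ < 2⁻³²`, `(∃ r, UFSC0 d 2 p r ε₀) ↔ p_c(2) < p` — (←) T4s `ufsc0_two_of_rcCriticalProb_lt`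
(CONDITIONAL on the named fact), (→) C3b ∧ C2 (unconditional). [cite: Bodineau2005, Thm. 2.1] [cite: Severo2024, Thm. 1.1]
[cite: KozmaNitzan2024, §4 Theorem 6] [cite: Grimmett2006, Thm. (5.5), Conj. (5.103)] -/
theorem exists_ufsc0_two_iff_rcCriticalProb_lt (hB : Bodineau2005_slabThreshold) (hd : 3 ≤ d) (hε₀ : 0 < ε₀)
    (hε : 4 * ε₀ < (1 / 2 : ℝ) ^ 32) (p : unitInterval) (hp : (p : ℝ) ∈ Set.Ioo 0 1) :
    (∃ r : ℕ, UFSC0 d 2 p r ε₀) ↔ rcCriticalProb d 2 < (p : ℝ) :=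
  ⟨fun ⟨_, hU⟩ => rcCriticalProb_lt_of_ufsc0_of_one_le (by norm_num) hε hp.1 hp.2 hU,
    fun hlt => ufsc0_two_of_rcCriticalProb_lt hB hd hε₀ p hp hlt⟩

/-- **`q = 2`, `d ≥ 3`: the record's binder 2 is IDLE** (given Bodineau's theorem): for `p ∈ (0,1)` and `ε₀ > 0`,
`FH d 2 p` ALONE gives `∃ r, UFSC0 d 2 p r ε₀` — binder 1 forces `p_c(2) < p` (`fh_two_iff_rcCriticalProb_lt`, T1s-B;
uses `not_fh_two_at_critical`, i.e. ADS 2015, at `p_c(2)`) and the slab route supplies the conclusion there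
(`ufsc0_two_of_rcCriticalProb_lt`), bypassing TP_FK = `KNFreeTargetHittable d 2 p` (which stays OPEN; T1s-B's
`ufsc0_two_of_targetHittable` needed it). NOT a re-cut of the record `_r3` (general `q ≥ 1`), not `_r4`.
[cite: Bodineau2005, Thm. 2.1] [cite: KozmaNitzan2024, §4 Theorem 6 (pp. 25–31)] [cite: Grimmett2006, Conj. (5.103)] -/
theorem ufsc0_two_of_fh (hB : Bodineau2005_slabThreshold) (hd : 3 ≤ d) (hε₀ : 0 < ε₀) (p : unitInterval)
    (hp : (p : ℝ) ∈ Set.Ioo 0 1) (hFH : FH d 2 p) : ∃ r : ℕ, UFSC0 d 2 p r ε₀ :=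
  ufsc0_two_of_rcCriticalProb_lt hB hd hε₀ p hp ((fh_two_iff_rcCriticalProb_lt hB hd).1 hFH)

/-- **`q = 2`, `d ≥ 3`: conclusion ⟺ binder 1** (given Bodineau's theorem): for `p ∈ (0,1)`, `ε₀ > 0`, `4ε₀ < 2⁻³²`,
`(∃ r, UFSC0 d 2 p r ε₀) ↔ FH d 2 p` (both sides `↔ p_c(2) < p`).
[cite: Bodineau2005, Thm. 2.1] [cite: KozmaNitzan2024, §4 Theorem 6] [cite: Grimmett2006, Conj. (5.103)] -/
theorem exists_ufsc0_two_iff_fh (hB : Bodineau2005_slabThreshold) (hd : 3 ≤ d) (hε₀ : 0 < ε₀)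
    (hε : 4 * ε₀ < (1 / 2 : ℝ) ^ 32) (p : unitInterval) (hp : (p : ℝ) ∈ Set.Ioo 0 1) :
    (∃ r : ℕ, UFSC0 d 2 p r ε₀) ↔ FH d 2 p :=
  (exists_ufsc0_two_iff_rcCriticalProb_lt hB hd hε₀ hε p hp).trans (fh_two_iff_rcCriticalProb_lt hB hd).symm

/-- **The Ising slab route, one screen** (`q = 2`, `d ≥ 3`, `p ∈ (0,1)`, `ε₀ > 0`, `4ε₀ < 2⁻³²`;
given Bodineau's theorem): the following are equivalent — (1) `p_c(2) < p`; (2) free slab percolation `Π(p, L)` at some thickness;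
(3) binder 1 `FH d 2 p`; (4) the record's conclusion `∃ r, UFSC0 d 2 p r ε₀`; (5) free percolation `0 < θ⁰(p, 2)`.
Arrows: (1)→(2) Bodineau (named fact); (2)→(3) T1s-B `fh_of_fkSlabPercolation`; (2)→(4) T4s; (4)→(1) C3b ∧ C2;
(3)→(5) T1c `thetaFree_pos_of_fh`; (5)→(1) (5.3) + `θ⁰(p_c(2),2) = 0` (ADS 2015). The general-`q` picture keeps
(2)→(3), (2)→(4), (4)→(1), (3)→(5), (5)→`p_c(q) ≤ p` and loses exactly the two named inputs.
[cite: Bodineau2005, Thm. 2.1] [cite: Severo2024, Thm. 1.1] [cite: AizenmanDuminilCopinSidoraviciusCMP2015, Thm. 1.2]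
[cite: KozmaNitzan2024, §4 Theorem 6] [cite: Grimmett2006, §5.7 eq. (5.102), Conj. (5.103), §5.1 (5.3)] -/
theorem ising_slabRoute_tfae (hB : Bodineau2005_slabThreshold) (hd : 3 ≤ d) (hε₀ : 0 < ε₀)
    (hε : 4 * ε₀ < (1 / 2 : ℝ) ^ 32) (p : unitInterval) (hp : (p : ℝ) ∈ Set.Ioo 0 1) :
    List.TFAE [rcCriticalProb d 2 < (p : ℝ), ∃ L : ℕ, FKSlabPercolation d (p : ℝ) 2 L, FH d 2 p,
      ∃ r : ℕ, UFSC0 d 2 p r ε₀, 0 < thetaFree d p 2] := by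
  haveI : NeZero d := ⟨by omega⟩
  tfae_have 1 → 2 := fun hlt => hB.fkSlabPercolation hd p.2 hlt
  tfae_have 2 → 3 := fun ⟨L, hL⟩ => fh_of_fkSlabPercolation hd (by norm_num) hL
  tfae_have 2 → 4 := fun hSP => ufsc0_of_exists_fkSlabPercolation hd (by norm_num) hε₀ p hp hSP
  tfae_have 4 → 1 := fun ⟨r, hU⟩ => rcCriticalProb_lt_of_ufsc0_of_one_le (by norm_num) hε hp.1 hp.2 hU
  tfae_have 3 → 5 := fun h => thetaFree_pos_of_fh (by norm_num) h
  tfae_have 5 → 1 := fun hθ => by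
    refine lt_of_le_of_ne (rcCriticalProb_le_of_thetaFree_pos (by norm_num) p.2 hθ) fun heq => ?_
    have h0 : thetaFree d (p : ℝ) 2 = 0 := by rw [← heq]; exact thetaFree_rcCriticalProb_two_eq_zero hd
    exact hθ.ne' h0
  tfae_finish

/-! ### §4. Every `q ≥ 1`: the threshold of the record's conclusion lies in the K1 interval `[p_c(q), p̂_c(q)]` -/

/-- **The threshold of the record's conclusion is pinned in `[p_c(q), p̂_c(q)]`** (`d ≥ 3`, `q ≥ 1`, `0 < ε₀`,
`4ε₀ < 2⁻³²`). With `U := {x ∈ (0,1] | ∃ r, UFSC0 d q x r ε₀}` written inline (no definition is introduced):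
`p_c(q) ≤ inf U ≤ p̂_c(q)` — `U` is non-empty (it contains `(p̂_c(q), 1)`, T4s, and `p̂_c(q) < 1`, T1t-C
`fkSlabCriticalProb_lt_one`), every point of `U` below `1` exceeds `p_c(q)` (C3b ∧ C2), and every `x ∈ (p̂_c(q), 1)` lies
in `U`. So the `p`-threshold of `∃ r, UFSC0 d q p r ε₀` sits in the K1 interval, whose length is Conj.
(5.103)'s defect (`0` for `q ∈ {1,2}` in print). `U` need not be an up-set (validity of histories moves with `p`); only its
infimum is located. [cite: Grimmett2006, §5.7 eq. (5.102), Conj. (5.103), Thm. (5.5)] [cite: KozmaNitzan2024, §4 Theorem 6 (pp. 25–31)] -/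
theorem csInf_ufsc0Set_mem_Icc (hd : 3 ≤ d) (hq : 1 ≤ q) (hε₀ : 0 < ε₀) (hε : 4 * ε₀ < (1 / 2 : ℝ) ^ 32) :
    sInf {x : ℝ | ∃ p : unitInterval, (p : ℝ) = x ∧ 0 < x ∧ ∃ r : ℕ, UFSC0 d q p r ε₀} ∈
      Set.Icc (rcCriticalProb d q) (fkSlabCriticalProb d q) := by
  set U : Set ℝ := {x : ℝ | ∃ p : unitInterval, (p : ℝ) = x ∧ 0 < x ∧ ∃ r : ℕ, UFSC0 d q p r ε₀} with hU
  have hq0 : 0 < q := one_pos.trans_le hq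
  have hsc1 : fkSlabCriticalProb d q < 1 := fkSlabCriticalProb_lt_one (d := d) (by omega) hq
  have hsc0 : 0 ≤ fkSlabCriticalProb d q := (fkSlabCriticalProb_mem_Icc (d := d) hq0).1
  -- every `x ∈ (p̂_c(q), 1)` is in `U` (T4s)
  have hmem : ∀ x : ℝ, fkSlabCriticalProb d q < x → x < 1 → x ∈ U := fun x hx hx1 => by
    have hx0 : 0 < x := hsc0.trans_lt hx
    refine ⟨⟨x, hx0.le, hx1.le⟩, rfl, hx0, ?_⟩
    exact ufsc0_of_fkSlabCriticalProb_lt hd hq hε₀ ⟨x, hx0.le, hx1.le⟩ ⟨hx0, hx1⟩ hx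
  obtain ⟨x₀, hx₀, hx₀1⟩ := exists_between hsc1
  have hne : U.Nonempty := ⟨x₀, hmem x₀ hx₀ hx₀1⟩
  have hbdd : BddBelow U := ⟨0, fun y ⟨_, _, hy0, _⟩ => hy0.le⟩
  refine ⟨le_csInf hne fun y hy => ?_, le_of_forall_gt_imp_ge_of_dense fun z hz => ?_⟩
  · -- lower bound: every point of `U` is `≥ p_c(q)` (C3b ∧ C2 below `1`; `p_c(q) ≤ 1` at `1`)
    obtain ⟨p, hpy, hy0, r, hUr⟩ := hy
    rcases lt_or_ge y 1 with hy1 | hy1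
    · subst hpy
      exact (rcCriticalProb_lt_of_ufsc0_of_one_le hq hε hy0 hy1 hUr).le
    · exact (rcCriticalProb_mem_Icc d q).2.trans hy1
  · -- upper bound: `inf U ≤ z` for every `z > p̂_c(q)`
    obtain ⟨x, hx, hxz⟩ := exists_between (lt_min hz hsc1)
    exact (csInf_le hbdd (hmem x hx (hxz.trans_le (min_le_right _ _)))).trans
      (hxz.le.trans (min_le_left _ _))

/-! ### §5. With `UFSC0SlabPercolation`: finite free slabs `Π(p, L)` ⟹ `φ⁰_{p,q}` percolates in a slab at the SAME `p`; every DLR measure does -/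

/-- **The slab route, same `p`, infinite volume** (`d ≥ 3`, `q ≥ 1`, `0 < p < 1`): Grimmett's FINITE free-slab
property `Π(p, L)` forces the free infinite-volume measure `φ⁰_{p,q}` to percolate inside a slab at the SAME `p`
(T4s `ufsc0_of_fkSlabPercolation` at `ε₀ = 2⁻³⁵`, then `slabPercolation_rcLimit_free_of_ufsc0`) — the passage from
free finite slabs to the free measure of `ℤ^d` restricted to a (thicker) slab, for every `q ≥ 1`, through the KN
machine. [cite: Grimmett2006, §5.7 eq. (5.102), Thm. (4.19)(a)] [cite: KozmaNitzan2024, §4 Theorem 6] -/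
theorem slabPercolation_rcLimit_free_of_fkSlabPercolation (hd : 3 ≤ d) (hq : 1 ≤ q) (p : unitInterval)
    (hp : (p : ℝ) ∈ Set.Ioo 0 1) {L : ℕ} (hSP : FKSlabPercolation d (p : ℝ) q L) :
    ∃ (a b : Fin d) (w : ℕ), a ≠ b ∧
      0 < (rcLimit d false (p : ℝ) q).real (percolatesVia (withinGraph (zdGraph d)
        {x : Site d | ∀ j : Fin d, j ≠ a → j ≠ b → |x j| ≤ (w : ℤ)}) (0 : Site d)) := by
  have hε₀ : (0 : ℝ) < (1 / 2) ^ 35 := by positivity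
  obtain ⟨r, hU⟩ := ufsc0_of_fkSlabPercolation hd hq hε₀ p hp hSP
  obtain ⟨a, b, hab, hpos⟩ := slabPercolation_rcLimit_free_of_ufsc0 hq (by norm_num) hp hU
  exact ⟨a, b, 5 * r, hab, by push_cast; exact hpos⟩

/-- **`UFSC0` at `p` ⟹ EVERY infinite-volume random-cluster measure at `(p, q)` percolates inside a slab at the SAME `p`**
(every `d`, `q ≥ 1`, `0 < p < 1`, `4ε₀ ≤ 2⁻³²`): for every `P` with the `FKGibbs` sandwich (every DLR / limit measure, free,
wired or otherwise) there are axes `a ≠ b` with `P(0 ↔ ∞ inside {x : |x_j| ≤ 5r, j ∉ {a,b}}) > 0` — the sister leaf's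
`slabPercolation_rcLimit_free_of_ufsc0` for the minimal measure `φ⁰_{p,q}` and the stochastic order `φ⁰_{p,q} ≤ P` on
increasing events (rows FO-06, `FKGibbs.rcLimit_false_real_le_of_measurableSet`, Grimmett Thm. (4.34)(b)).
[cite: Grimmett2006, Thm. (4.34)(b) eq. (4.35), §5.7 Conj. (5.103)] [cite: KozmaNitzan2024, §4 Theorem 6] -/
theorem slabPercolation_fkGibbs_of_ufsc0 (hq : 1 ≤ q) (hε : 4 * ε₀ ≤ (1 / 2 : ℝ) ^ 32) {p : unitInterval}
    (hp : (p : ℝ) ∈ Set.Ioo 0 1) {r : ℕ} (hU : UFSC0 d q p r ε₀) {P : Measure (BondConfig (Site d))}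
    (hG : FKGibbs d p q P) :
    ∃ a b : Fin d, a ≠ b ∧
      0 < P.real (percolatesVia (withinGraph (zdGraph d)
        {x : Site d | ∀ j : Fin d, j ≠ a → j ≠ b → |x j| ≤ 5 * (r : ℤ)}) (0 : Site d)) := by
  obtain ⟨a, b, hab, hpos⟩ := slabPercolation_rcLimit_free_of_ufsc0 hq hε hp hU
  exact ⟨a, b, hab, hpos.trans_le (hG.rcLimit_false_real_le_of_measurableSet p.2 hq
    (isUpperSet_percolatesVia _ _) (measurableSet_percolatesVia _ _))⟩

end Summit.CriticalPhenomena.PercolationContinuityZ3.Theorems.FK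

end
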